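import Literature.AlgebraicGeometry.Resolution.SymbolicPowersRsop
import Literature.AlgebraicGeometry.Resolution.RegularLocalOrder
import Literature.AlgebraicGeometry.Resolution.RegularLocalRingsQuotient
import HarnessLib

/-!
# Parts of regular systems of parameters and the monomial ideals they generate

Topic: `Literature/AlgebraicGeometry/Resolution`. Local algebra for strict normal crossings
divisors (de Jong 1996, 2.4; Stacks 0BI9: at a point, `D = V(x₁ ⋯ x_r)` with `x₁, …, x_r` part of
a regular system of parameters of the regular local ring `𝒪_{X,p}`), used by the decomposition
of `DeJong1996NormalCrossingsBlowup` (`NormalCrossingsStrictification.lean`). Everything is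
PROVED, on top of Matsumura Thms. 14.2, 14.3, 17.8, 17.10 as formalized in
`RegularLocalRingsProofs.lean`, `RegularSystemOfParameters.lean`, `SymbolicPowersRsop.lean`,
`RegularLocalOrder.lean`.

* `IsRsopPart z` — the family `z : Fin n → R` is part of a regular system of parameters of the
  regular local ring `R` (the shape used in `IsStrictNormalCrossingsDivisor`:
  `dim R = n + e` and `𝔪 = (z, y)` for some `y : Fin e → R`).
* Bridge to the `(hd, x, hx)` format of the tree (`IsRsopPart.exists_rsop`,
  `isRsopPart_comp_of_rsop`), sub-families (`IsRsopPart.comp`, `append_left/right`),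
  associated families.
* Matsumura 14.2/14.3 consequences: `isRegularLocalRing_quotient`, `ringKrullDim_quotient_add`,
  `isPrime_span_range`, `not_mem_sq`, `prime`, `injective`, `not_associated`.
* **Criterion** `IsRsopPart.of_isRegularLocalRing_quotient`: in a Noetherian local ring `Q`, if
  `z₁, …, z_n ∈ 𝔪` have a regular local quotient `Q/(z)` with `dim Q/(z) + n ≥ dim Q`, then `Q`
  is regular and `z` is part of a regular system of parameters (embedding-dimension count;
  Matsumura, Remark after Thm. 14.2).
* Orders: `prod_mem_pow`, `prod_not_mem_pow_succ`, `span_prod_le_pow_iff` (`ord(u ∏ zᵢ) = n`).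
* Radicals: `span_prod_eq_iInf` (`(∏ zᵢ) = ⋂ (zᵢ)`), `isRadical_span_prod`,
  `radical_span_prod_pow` (`√(u ∏ zᵢ^{aᵢ}) = (∏ zᵢ)` for `aᵢ ≥ 1`).
* Factorisation: `exists_associated_prod_of_mul_eq_prod` (a divisor of a product of primes is a
  subproduct, in any cancellative monoid with zero), `exists_associated_of_prime_dvd_prod`.
* `span_prod_inf_span_range` — `(∏ fⱼ) ∩ (c₁, …, c_m) = (∏ fⱼ) · (c₁, …, c_m)` for disjoint parts
  `f`, `c` of one regular system of parameters.

## Sources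

* H. Matsumura, *Commutative Ring Theory*, CUP 1986, Thm. 14.2 and the Remark following its
  proof, Thm. 14.3, Thm. 17.8, Thm. 17.10. [Matsumura1987]
* The Stacks Project, Tag 0BI9, Tag 00NP. [StacksProject]
-/

noncomputable section

namespace Literature.AlgebraicGeometry.Resolution

universe u

open IsLocalRing

/-! ## Auxiliary -/

/-- Two families with pairwise associated members generate the same ideal. [folklore] -/
theorem Ideal.span_range_eq_of_associated {R : Type*} [CommRing R] {ι : Type*} {z z' : ι → R}
    (h : ∀ i, Associated (z i) (z' i)) : Ideal.span (Set.range z) = Ideal.span (Set.range z') := by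
  apply le_antisymm <;> rw [Ideal.span_le] <;> rintro _ ⟨i, rfl⟩
  · obtain ⟨u, hu⟩ := (h i).symm
    rw [← hu]
    exact Ideal.mul_mem_right _ _ (Ideal.subset_span ⟨i, rfl⟩)
  · obtain ⟨u, hu⟩ := h i
    rw [← hu]
    exact Ideal.mul_mem_right _ _ (Ideal.subset_span ⟨i, rfl⟩)

variable {R : Type u} [CommRing R]

/-! ## Parts of regular systems of parameters -/

/-- `z₁, …, z_n` **is part of a regular system of parameters** of `R`: `R` is a regular local
ring of dimension `n + e` whose maximal ideal is generated by the `zᵢ` together with `e` further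
elements `y₁, …, y_e` (so `(z, y)` is a minimal basis of `𝔪`, Matsumura §14). This is the shape
of the local condition in `IsStrictNormalCrossingsDivisor` (Stacks 0BI9). [folklore] -/
def IsRsopPart [IsLocalRing R] {n : ℕ} (z : Fin n → R) : Prop :=
  IsRegularLocalRing R ∧ ∃ (e : ℕ) (y : Fin e → R), ringKrullDim R = (n + e : ℕ) ∧
    Ideal.span (Set.range z ∪ Set.range y) = maximalIdeal R

namespace IsRsopPart

variable [IsLocalRing R] {n : ℕ} {z : Fin n → R}

/-- The ambient ring is regular local. [folklore] -/
theorem isRegularLocalRing (hz : IsRsopPart z) : IsRegularLocalRing R :=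
  hz.1

/-- **Bridge to a full regular system of parameters**: `z` consists of the first `n` members of
a minimal basis `x : Fin d → R` of `𝔪` with `d = emb dim R`. [folklore] -/
theorem exists_rsop (hz : IsRsopPart z) :
    ∃ (e : ℕ) (x : Fin (n + e) → R), (maximalIdeal R).spanFinrank = n + e ∧
      Ideal.span (Set.range x) = maximalIdeal R ∧ ∀ i, x (Fin.castAdd e i) = z i := by
  obtain ⟨hR, e, y, hdim, hspan⟩ := hz
  -- `range (Fin.append z y) = range z ∪ range y` (`range_fin_append` of `AlterationsEnlargingZ`)
  have hr : Set.range (Fin.append z y) = Set.range z ∪ Set.range y := by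
    ext a
    constructor
    · rintro ⟨i, rfl⟩
      induction i using Fin.addCases with
      | left j => exact Or.inl ⟨j, by simp⟩
      | right k => exact Or.inr ⟨k, by simp⟩
    · rintro (⟨j, rfl⟩ | ⟨k, rfl⟩)
      · exact ⟨Fin.castAdd e j, by simp⟩
      · exact ⟨Fin.natAdd n k, by simp⟩
  refine ⟨e, Fin.append z y, ?_, by rwa [hr], fun i => by simp⟩
  have h := IsRegularLocalRing.spanFinrank_maximalIdeal (R := R)
  rw [hdim] at h
  exact_mod_cast h

/-- Members of a part of a regular system of parameters lie in `𝔪`. [folklore] -/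
theorem mem_maximalIdeal (hz : IsRsopPart z) (i : Fin n) : z i ∈ maximalIdeal R := by
  obtain ⟨-, e, y, -, hspan⟩ := hz
  exact hspan ▸ Ideal.subset_span (Or.inl ⟨i, rfl⟩)

/-- The ideal generated by a part of a regular system of parameters is proper. [folklore] -/
theorem span_range_le_maximalIdeal (hz : IsRsopPart z) :
    Ideal.span (Set.range z) ≤ maximalIdeal R := by
  rw [Ideal.span_le]
  rintro _ ⟨i, rfl⟩
  exact hz.mem_maximalIdeal i

/-- The ideal generated by a part of a regular system of parameters is not the unit ideal.
[folklore] -/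
theorem span_range_ne_top (hz : IsRsopPart z) : Ideal.span (Set.range z) ≠ ⊤ := fun h =>
  (maximalIdeal.isMaximal R).ne_top (top_le_iff.mp (h ▸ hz.span_range_le_maximalIdeal))

end IsRsopPart

/-- **A sub-family of a regular system of parameters is a part of one**: for a minimal basis
`x : Fin d → R` of `𝔪` (`d = emb dim R`) of a regular local ring and an injective
`ι : Fin n → Fin d`, the family `x ∘ ι` is part of a regular system of parameters.
[cite: Matsumura1987, Thm. 14.2] -/
theorem isRsopPart_comp_of_rsop [IsRegularLocalRing R] {d : ℕ}
    (hd : (maximalIdeal R).spanFinrank = d) (x : Fin d → R)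
    (hx : Ideal.span (Set.range x) = maximalIdeal R) {n : ℕ} (ι : Fin n → Fin d)
    (hι : Function.Injective ι) : IsRsopPart (x ∘ ι) := by
  classical
  -- enumerate the complement of the range of `ι`
  set T : Finset (Fin d) := Finset.univ \ Finset.univ.image ι with hT
  have hcard : T.card = d - n := by
    rw [hT, Finset.card_sdiff_of_subset (Finset.subset_univ _), Finset.card_univ, Fintype.card_fin,
      Finset.card_image_of_injective _ hι, Finset.card_univ, Fintype.card_fin]
  have hn : n ≤ d := by
    simpa using Fintype.card_le_of_injective ι hι
  let κ : Fin (d - n) → Fin d := fun j => T.orderEmbOfFin hcard j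
  refine ⟨‹_›, d - n, x ∘ κ, ?_, ?_⟩
  · have h := IsRegularLocalRing.spanFinrank_maximalIdeal (R := R)
    rw [hd] at h
    rw [← h, Nat.add_sub_cancel' hn]
  · rw [← hx]
    apply le_antisymm <;> rw [Ideal.span_le]
    · rintro _ (⟨i, rfl⟩ | ⟨j, rfl⟩) <;> exact Ideal.subset_span ⟨_, rfl⟩
    · rintro _ ⟨k, rfl⟩
      by_cases hk : k ∈ Finset.univ.image ι
      · obtain ⟨i, -, rfl⟩ := Finset.mem_image.mp hk
        exact Ideal.subset_span (Or.inl ⟨i, rfl⟩)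
      · have hkT : k ∈ T := by
          rw [hT, Finset.mem_sdiff]
          exact ⟨Finset.mem_univ _, hk⟩
        have hkr : k ∈ Set.range (T.orderEmbOfFin hcard) := by
          rw [Finset.range_orderEmbOfFin]
          exact hkT
        obtain ⟨j, hj⟩ := hkr
        exact Ideal.subset_span (Or.inr ⟨j, by simp only [Function.comp_apply]; rw [← hj]⟩)

namespace IsRsopPart

variable [IsLocalRing R] {n : ℕ} {z : Fin n → R}

/-- **Sub-families**: if `z` is part of a regular system of parameters and `ι : Fin k → Fin n`
is injective, then `z ∘ ι` is part of a regular system of parameters. [folklore] -/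
theorem comp (hz : IsRsopPart z) {k : ℕ} (ι : Fin k → Fin n) (hι : Function.Injective ι) :
    IsRsopPart (z ∘ ι) := by
  haveI := hz.isRegularLocalRing
  obtain ⟨e, x, hd, hx, hxz⟩ := hz.exists_rsop
  have : z ∘ ι = x ∘ (Fin.castAdd e ∘ ι) := by
    ext i
    simp [hxz]
  rw [this]
  exact isRsopPart_comp_of_rsop hd x hx _ ((Fin.castAdd_injective n e).comp hι)

/-- The left block of an appended part of a regular system of parameters is one. [folklore] -/
theorem append_left {k m : ℕ} {f : Fin k → R} {c : Fin m → R} (h : IsRsopPart (Fin.append f c)) :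
    IsRsopPart f := by
  have := h.comp (Fin.castAdd m) (Fin.castAdd_injective k m)
  rwa [show Fin.append f c ∘ Fin.castAdd m = f from funext fun i => by simp] at this

/-- The right block of an appended part of a regular system of parameters is one. [folklore] -/
theorem append_right {k m : ℕ} {f : Fin k → R} {c : Fin m → R} (h : IsRsopPart (Fin.append f c)) :
    IsRsopPart c := by
  have := h.comp (Fin.natAdd k) (Fin.natAdd_injective m k)
  rwa [show Fin.append f c ∘ Fin.natAdd k = c from funext fun i => by simp] at this

/-- Reindexing along an equivalence. [folklore] -/
theorem comp_equiv (hz : IsRsopPart z) (σ : Fin n ≃ Fin n) : IsRsopPart (z ∘ σ) :=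
  hz.comp σ σ.injective

/-- A family with members associated to those of a part of a regular system of parameters is
again one (e.g. multiplying each `zᵢ` by a unit). [folklore] -/
theorem of_associated (hz : IsRsopPart z) {z' : Fin n → R} (h : ∀ i, Associated (z i) (z' i)) :
    IsRsopPart z' := by
  obtain ⟨hR, e, y, hdim, hspan⟩ := hz
  refine ⟨hR, e, y, hdim, ?_⟩
  rw [← hspan, Ideal.span_union, Ideal.span_union, Ideal.span_range_eq_of_associated h]

/-- **Matsumura 14.2 (1) ⇒ (3) and 14.3**: the quotient of `R` by a part of a regular system of
parameters is a regular local ring of dimension `dim R - n`, and the members of the part have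
linearly independent differentials. Packaged from `quotient_isRegularLocalRing_tfae`.
[cite: Matsumura1987, Thm. 14.2] -/
theorem tfae_out (hz : IsRsopPart z) :
    haveI := hz.isRegularLocalRing
    IsRegularLocalRing (R ⧸ Ideal.span (Set.range z)) ∧
      ringKrullDim (R ⧸ Ideal.span (Set.range z)) + n = ringKrullDim R ∧
      Function.Injective z ∧ ∀ i, z i ∉ maximalIdeal R ^ 2 := by
  classical
  haveI := hz.isRegularLocalRing
  obtain ⟨e, x, hd, hx, hxz⟩ := hz.exists_rsop
  -- minimality of the basis `x`: injectivity
  have hxinj : Function.Injective x := by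
    intro i j hij
    by_contra hne
    have := not_mem_span_image_of_not_mem hd x hx (S := {j}) (i := i) (by simpa using hne)
    exact this (hij ▸ Ideal.subset_span ⟨j, rfl, rfl⟩)
  have hzinj : Function.Injective z := by
    intro i j hij
    have : x (Fin.castAdd e i) = x (Fin.castAdd e j) := by rw [hxz, hxz, hij]
    exact Fin.castAdd_injective n e (hxinj this)
  -- the finsets of values
  set S : Finset R := Finset.univ.image z with hS
  set T : Finset R := Finset.univ.image x with hT
  have hScoe : (S : Set R) = Set.range z := by
    rw [hS, Finset.coe_image, Finset.coe_univ, Set.image_univ]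
  have hTcoe : (T : Set R) = Set.range x := by
    rw [hT, Finset.coe_image, Finset.coe_univ, Set.image_univ]
  have hScard : S.card = n := by
    rw [hS, Finset.card_image_of_injective _ hzinj, Finset.card_univ, Fintype.card_fin]
  have hTcard : T.card = n + e := by
    rw [hT, Finset.card_image_of_injective _ hxinj, Finset.card_univ, Fintype.card_fin]
  have hsub : (S : Set R) ⊆ maximalIdeal R := by
    rw [hScoe]
    rintro _ ⟨i, rfl⟩
    exact hz.mem_maximalIdeal i
  have hST : S ⊆ T := by
    intro a ha
    obtain ⟨i, -, rfl⟩ := Finset.mem_image.mp ha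
    exact Finset.mem_image.mpr ⟨Fin.castAdd e i, Finset.mem_univ _, hxz i⟩
  have h1 : ∃ T : Finset R, S ⊆ T ∧ (T.card : WithBot ℕ∞) = ringKrullDim R ∧
      Ideal.span (T : Set R) = maximalIdeal R := by
    refine ⟨T, hST, ?_, hTcoe ▸ hx⟩
    rw [hTcard, ← hd]
    exact IsRegularLocalRing.spanFinrank_maximalIdeal
  have tfae := quotient_isRegularLocalRing_tfae R S hsub
  have h3 := (tfae.out 0 2).mp h1
  have h2 := (tfae.out 0 1).mp h1
  rw [hScoe, hScard] at h3
  refine ⟨h3.1, h3.2, hzinj, fun i hi => ?_⟩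
  -- `z i ∈ 𝔪²` would make its differential vanish
  have hmem : z i ∈ S := Finset.mem_image.mpr ⟨i, Finset.mem_univ _, rfl⟩
  have h0 : ((maximalIdeal R).toCotangent ∘ Set.inclusion hsub) ⟨z i, hmem⟩ = 0 := by
    simp only [Function.comp_apply]
    rw [Ideal.toCotangent_eq_zero]
    exact hi
  exact h2.ne_zero ⟨z i, hmem⟩ h0

/-- The quotient by a part of a regular system of parameters is a regular local ring
(Matsumura 14.2). [cite: Matsumura1987, Thm. 14.2] -/
theorem isRegularLocalRing_quotient (hz : IsRsopPart z) :
    IsRegularLocalRing (R ⧸ Ideal.span (Set.range z)) :=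
  hz.tfae_out.1

/-- `dim R/(z₁, …, z_n) + n = dim R` (Matsumura 14.2). [cite: Matsumura1987, Thm. 14.2] -/
theorem ringKrullDim_quotient_add (hz : IsRsopPart z) :
    ringKrullDim (R ⧸ Ideal.span (Set.range z)) + n = ringKrullDim R :=
  hz.tfae_out.2.1

/-- A part of a regular system of parameters has no repetitions. [folklore] -/
theorem injective (hz : IsRsopPart z) : Function.Injective z :=
  hz.tfae_out.2.2.1

/-- Members of a part of a regular system of parameters have order one: `zᵢ ∉ 𝔪²`.
[cite: Matsumura1987, Thm. 14.2] -/
theorem not_mem_sq (hz : IsRsopPart z) (i : Fin n) : z i ∉ maximalIdeal R ^ 2 :=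
  hz.tfae_out.2.2.2 i

/-- The ideal of a part of a regular system of parameters is prime (Matsumura 14.3 for the
regular quotient). [cite: Matsumura1987, Thm. 14.3] -/
theorem isPrime_span_range (hz : IsRsopPart z) : (Ideal.span (Set.range z)).IsPrime := by
  haveI := hz.isRegularLocalRing_quotient
  haveI : IsDomain (R ⧸ Ideal.span (Set.range z)) := isDomain_of_isRegularLocalRing _
  exact (Ideal.Quotient.isDomain_iff_prime _).mp inferInstance

/-- Members of a part of a regular system of parameters are nonzero. [folklore] -/
theorem ne_zero (hz : IsRsopPart z) (i : Fin n) : z i ≠ 0 := fun h =>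
  hz.not_mem_sq i (h ▸ zero_mem _)

/-- **Members of a part of a regular system of parameters are prime elements** (`R/(zᵢ)` is a
regular local ring, hence a domain). [cite: Matsumura1987, Thm. 14.3] -/
theorem prime (hz : IsRsopPart z) (i : Fin n) : Prime (z i) := by
  have h := (hz.comp (fun _ : Fin 1 => i) fun a b _ => Subsingleton.elim a b).isPrime_span_range
  have hr : Set.range (z ∘ fun _ : Fin 1 => i) = {z i} := by
    ext a
    simp only [Set.mem_range, Function.comp_apply, exists_const, Set.mem_singleton_iff]
    exact eq_comm
  rw [hr] at h
  exact (Ideal.span_singleton_prime (hz.ne_zero i)).mp h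

/-- A member of a part of a regular system of parameters does not lie in the ideal generated by
the other members (minimality). [cite: Matsumura1987, Thm. 14.2] -/
theorem not_mem_span_image (hz : IsRsopPart z) {S : Set (Fin n)} {i : Fin n} (hi : i ∉ S) :
    z i ∉ Ideal.span (z '' S) := by
  haveI := hz.isRegularLocalRing
  obtain ⟨e, x, hd, hx, hxz⟩ := hz.exists_rsop
  have h := not_mem_span_image_of_not_mem hd x hx (S := Fin.castAdd e '' S) (i := Fin.castAdd e i)
    (fun hmem => by
      obtain ⟨j, hj, hji⟩ := hmem
      exact hi ((Fin.castAdd_injective n e hji) ▸ hj))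
  rwa [hxz, ← Set.image_comp, show x ∘ Fin.castAdd e = z from funext hxz] at h

/-- Distinct members of a part of a regular system of parameters are not associated. [folklore] -/
theorem not_associated (hz : IsRsopPart z) {i j : Fin n} (hij : i ≠ j) :
    ¬ Associated (z i) (z j) := by
  intro h
  obtain ⟨u, hu⟩ := h.symm
  refine hz.not_mem_span_image (S := {j}) (i := i) (by simpa using hij) ?_
  rw [Set.image_singleton, ← hu]
  exact Ideal.mul_mem_right _ _ (Ideal.mem_span_singleton_self _)

/-- A member does not divide another member. [folklore] -/
theorem not_dvd (hz : IsRsopPart z) {i j : Fin n} (hij : i ≠ j) : ¬ z i ∣ z j := fun h =>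
  haveI := hz.isRegularLocalRing
  haveI := isDomain_of_isRegularLocalRing R
  hz.not_associated hij ((hz.prime i).irreducible.associated_of_dvd (hz.prime j).irreducible h)

end IsRsopPart

/-! ## The criterion: regular quotient of the right dimension -/

/-- **Criterion for being part of a regular system of parameters** (Matsumura, Remark after
Thm. 14.2: "(3) ⇒ (1)" needs no regularity hypothesis on `R`): in a Noetherian local ring `Q`,
if `z₁, …, z_n ∈ 𝔪` are such that `Q/(z₁, …, z_n)` is a regular local ring with
`dim Q/(z) + n ≤ dim Q` (equivalently `=`, the other inequality being Krull's), then `Q` is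
regular and `z` is part of a regular system of parameters. Indeed `𝔪` is generated by the `zᵢ`
and lifts of the `dim Q/(z)` generators of `𝔪̄`, so `emb dim Q ≤ n + dim Q/(z) ≤ dim Q`, while
`dim Q ≤ emb dim Q` always. [cite: Matsumura1987, Thm. 14.2 (Remark)] -/
theorem IsRsopPart.of_isRegularLocalRing_quotient [IsLocalRing R] [IsNoetherianRing R] {n : ℕ}
    {z : Fin n → R} (hzm : ∀ i, z i ∈ maximalIdeal R)
    [hq : IsRegularLocalRing (R ⧸ Ideal.span (Set.range z))]
    (hdim : ringKrullDim (R ⧸ Ideal.span (Set.range z)) + n ≤ ringKrullDim R) : IsRsopPart z := by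
  classical
  set I : Ideal R := Ideal.span (Set.range z) with hI
  -- lift a minimal basis of `𝔪̄`
  obtain ⟨ybar, hybar⟩ := exists_regularSystemOfParameters (R := R ⧸ I)
  generalize he : (maximalIdeal (R ⧸ I)).spanFinrank = e at ybar hybar
  choose y hy using fun j => Ideal.Quotient.mk_surjective (ybar j)
  have hdimq : ringKrullDim (R ⧸ I) = e := by
    rw [← he]; exact (IsRegularLocalRing.spanFinrank_maximalIdeal).symm
  -- `𝔪 = (z, y)`
  haveI hloc : IsLocalHom (Ideal.Quotient.mk I) :=
    IsLocalHom.of_surjective _ Ideal.Quotient.mk_surjective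
  have hspan : Ideal.span (Set.range z ∪ Set.range y) = maximalIdeal R := by
    apply le_antisymm
    · rw [Ideal.span_le]
      rintro a (⟨i, rfl⟩ | ⟨j, rfl⟩)
      · exact hzm i
      · have : Ideal.Quotient.mk I (y j) ∈ maximalIdeal (R ⧸ I) := by
          rw [hy, ← hybar]
          exact Ideal.subset_span ⟨j, rfl⟩
        exact (map_mem_nonunits_iff (Ideal.Quotient.mk I) (y j)).mp this
    · intro a ha
      have ha' : Ideal.Quotient.mk I a ∈ maximalIdeal (R ⧸ I) :=
        map_nonunit (Ideal.Quotient.mk I) a ha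
      rw [← hybar] at ha'
      have hrange : Set.range ybar = Ideal.Quotient.mk I '' Set.range y := by
        ext b
        constructor
        · rintro ⟨j, rfl⟩
          exact ⟨y j, ⟨j, rfl⟩, hy j⟩
        · rintro ⟨_, ⟨j, rfl⟩, rfl⟩
          exact ⟨j, (hy j).symm⟩
      rw [hrange, ← Ideal.map_span, Ideal.mem_map_iff_of_surjective _ Ideal.Quotient.mk_surjective]
        at ha'
      obtain ⟨b, hb, hab⟩ := ha'
      rw [Ideal.Quotient.eq] at hab
      have : a = b - (b - a) := by ring
      rw [this, Ideal.span_union]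
      exact Ideal.sub_mem _ (Ideal.mem_sup_right hb) (Ideal.mem_sup_left hab)
  -- count generators: `emb dim Q ≤ n + e`
  have hfin : (Set.range z ∪ Set.range y).Finite := (Set.finite_range z).union (Set.finite_range y)
  have hsf : (maximalIdeal R).spanFinrank ≤ n + e := by
    rw [← hspan]
    refine (Submodule.spanFinrank_span_le_ncard_of_finite hfin).trans ?_
    refine (Set.ncard_union_le _ _).trans (add_le_add ?_ ?_)
    · have h := Set.ncard_image_le (f := z) (s := Set.univ) Set.finite_univ
      rwa [Set.image_univ, Set.ncard_univ, Nat.card_eq_fintype_card, Fintype.card_fin] at h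
    · have h := Set.ncard_image_le (f := y) (s := Set.univ) Set.finite_univ
      rwa [Set.image_univ, Set.ncard_univ, Nat.card_eq_fintype_card, Fintype.card_fin] at h
  have hne : ((n + e : ℕ) : WithBot ℕ∞) = ringKrullDim (R ⧸ I) + n := by
    rw [hdimq]; push_cast; ring
  -- `emb dim Q ≤ n + e = dim Q/(z) + n ≤ dim Q`
  have hle2 : ((maximalIdeal R).spanFinrank : WithBot ℕ∞) ≤ ringKrullDim R :=
    calc ((maximalIdeal R).spanFinrank : WithBot ℕ∞) ≤ (n + e : ℕ) := by exact_mod_cast hsf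
      _ = ringKrullDim (R ⧸ I) + n := hne
      _ ≤ ringKrullDim R := hdim
  -- hence `Q` is regular of dimension `n + e`
  have hreg : IsRegularLocalRing R := IsRegularLocalRing.of_spanFinrank_maximalIdeal_le R hle2
  refine ⟨hreg, e, y, le_antisymm ?_ (hne ▸ hdim), hspan⟩
  calc ringKrullDim R ≤ (maximalIdeal R).spanFinrank := ringKrullDim_le_spanFinrank_maximalIdeal R
    _ ≤ (n + e : ℕ) := by exact_mod_cast hsf

/-! ## Orders of monomials in a part of a regular system of parameters -/

namespace IsRsopPart

variable [IsLocalRing R] {n : ℕ} {z : Fin n → R}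

/-- `∏ zᵢ ∈ 𝔪ⁿ`. [folklore] -/
theorem prod_mem_pow (hz : IsRsopPart z) : ∏ i, z i ∈ maximalIdeal R ^ n := by
  have h := Ideal.prod_mem_prod (s := Finset.univ) (I := fun _ : Fin n => maximalIdeal R)
    (x := z) fun i _ => hz.mem_maximalIdeal i
  rwa [Finset.prod_const, Finset.card_univ, Fintype.card_fin] at h

/-- **`ord(u · ∏ zᵢ) = n`**, upper half: `u ∏ zᵢ ∉ 𝔪ⁿ⁺¹` for a unit `u` (additivity of the order
in a regular local ring, Matsumura 17.10 / `mul_not_mem_pow_of_not_mem_pow`, and `zᵢ ∉ 𝔪²`).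
[cite: Matsumura1987, Thm. 17.10] -/
theorem unit_mul_prod_not_mem_pow_succ (hz : IsRsopPart z) {u : R} (hu : IsUnit u) :
    u * ∏ i, z i ∉ maximalIdeal R ^ (n + 1) := by
  haveI := hz.isRegularLocalRing
  induction n with
  | zero =>
    rw [Finset.univ_eq_empty, Finset.prod_empty, mul_one, zero_add, pow_one]
    exact fun h => hu.elim fun v hv => (maximalIdeal.isMaximal R).ne_top
      (Ideal.eq_top_of_isUnit_mem _ h (hv ▸ Units.isUnit v))
  | succ n ih =>
    rw [Fin.prod_univ_castSucc, ← mul_assoc]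
    have h1 : u * ∏ i : Fin n, z (Fin.castSucc i) ∉ maximalIdeal R ^ (n + 1) :=
      ih (hz.comp Fin.castSucc (Fin.castSucc_injective n))
    have h2 : z (Fin.last n) ∉ maximalIdeal R ^ (1 + 1) := hz.not_mem_sq (Fin.last n)
    exact mul_not_mem_pow_of_not_mem_pow h1 h2

/-- `∏ zᵢ ∉ 𝔪ⁿ⁺¹`. [cite: Matsumura1987, Thm. 17.10] -/
theorem prod_not_mem_pow_succ (hz : IsRsopPart z) : ∏ i, z i ∉ maximalIdeal R ^ (n + 1) := by
  simpa using hz.unit_mul_prod_not_mem_pow_succ isUnit_one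

/-- **The order of the principal ideal `(u ∏ zᵢ)` is `n`**: `(u ∏ zᵢ) ⊆ 𝔪ᵏ ↔ k ≤ n`. This
computes `idealOrder`/`branchOrder` at a point of a strict normal crossings divisor.
[cite: Matsumura1987, Thm. 17.10] -/
theorem span_unit_mul_prod_le_pow_iff (hz : IsRsopPart z) {u : R} (hu : IsUnit u) (k : ℕ) :
    Ideal.span {u * ∏ i, z i} ≤ maximalIdeal R ^ k ↔ k ≤ n := by
  rw [Ideal.span_singleton_le_iff_mem]
  constructor
  · intro h
    by_contra hk
    exact hz.unit_mul_prod_not_mem_pow_succ hu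
      (Ideal.pow_le_pow_right (by omega) h)
  · intro hk
    exact Ideal.pow_le_pow_right hk (Ideal.mul_mem_left _ _ hz.prod_mem_pow)

/-! ## Radicals -/

/-- **`(∏ zᵢ) = ⋂ (zᵢ)`** for a part `z` of a regular system of parameters: the `zᵢ` are
pairwise non-associated prime elements. [folklore] -/
theorem span_prod_eq_iInf (hz : IsRsopPart z) :
    Ideal.span {∏ i, z i} = ⨅ i, Ideal.span {z i} := by
  haveI := hz.isRegularLocalRing
  haveI := isDomain_of_isRegularLocalRing R
  induction n with
  | zero =>
    rw [Finset.univ_eq_empty, Finset.prod_empty, Ideal.span_singleton_one, iInf_of_empty]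
  | succ n ih =>
    have hz' := hz.comp Fin.succ (Fin.succ_injective n)
    apply le_antisymm
    · refine le_iInf fun i => ?_
      rw [Ideal.span_singleton_le_span_singleton]
      exact Finset.dvd_prod_of_mem _ (Finset.mem_univ i)
    · intro a ha
      rw [Fin.prod_univ_succ]
      have ha0 : a ∈ Ideal.span {z 0} := (iInf_le (fun i => Ideal.span {z i}) 0) ha
      obtain ⟨b, rfl⟩ := Ideal.mem_span_singleton'.mp ha0
      -- `b ∈ ⋂_{i ≥ 1} (zᵢ)` since `z₀ ∉ (zᵢ)` prime
      have hb : b ∈ ⨅ i : Fin n, Ideal.span {(z ∘ Fin.succ) i} := by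
        refine Ideal.mem_iInf.mpr fun i => ?_
        have hmem : b * z 0 ∈ Ideal.span {z i.succ} :=
          (Ideal.mem_iInf.mp ha) i.succ
        have hp : (Ideal.span {z i.succ}).IsPrime :=
          (Ideal.span_singleton_prime (hz.ne_zero _)).mpr (hz.prime _)
        refine (hp.mem_or_mem hmem).resolve_right fun h0 => ?_
        exact hz.not_dvd (Fin.succ_ne_zero i) (Ideal.mem_span_singleton.mp h0)
      rw [← ih hz'] at hb
      obtain ⟨c, rfl⟩ := Ideal.mem_span_singleton'.mp hb
      refine Ideal.mem_span_singleton'.mpr ⟨c, ?_⟩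
      simp only [Function.comp_apply]
      ring

/-- **The ideal `(∏ zᵢ)` is radical** (an intersection of prime ideals). [folklore] -/
theorem isRadical_span_prod (hz : IsRsopPart z) : (Ideal.span {∏ i, z i}).IsRadical := by
  haveI := hz.isRegularLocalRing
  haveI := isDomain_of_isRegularLocalRing R
  rw [hz.span_prod_eq_iInf]
  intro a ⟨k, hk⟩
  refine Ideal.mem_iInf.mpr fun i => ?_
  have hp : (Ideal.span {z i}).IsPrime := (Ideal.span_singleton_prime (hz.ne_zero _)).mpr (hz.prime _)
  exact hp.mem_of_pow_mem k ((Ideal.mem_iInf.mp hk) i)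

/-- **`√(u ∏ zᵢ^{aᵢ}) = (∏ zᵢ)`** for exponents `aᵢ ≥ 1` and a unit `u`: the reduced structure on
the total transform `V(x_i^{m} ∏ (x_j/x_i) ∏ y_l)` of a normal crossings divisor in a blow-up
chart. [folklore] -/
theorem radical_span_unit_mul_prod_pow (hz : IsRsopPart z) {u : R} (hu : IsUnit u) (a : Fin n → ℕ)
    (ha : ∀ i, 0 < a i) : (Ideal.span {u * ∏ i, z i ^ a i}).radical = Ideal.span {∏ i, z i} := by
  apply le_antisymm
  · rw [← hz.isRadical_span_prod.radical]
    apply Ideal.radical_mono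
    rw [Ideal.span_singleton_le_iff_mem, Ideal.mem_span_singleton]
    refine Dvd.dvd.mul_left (Finset.prod_dvd_prod_of_dvd _ _ fun i _ => ?_) u
    exact dvd_pow_self (z i) (ha i).ne'
  · rw [Ideal.span_singleton_le_iff_mem]
    -- `(∏ zᵢ)^N ∈ (u ∏ zᵢ^{aᵢ})` for `N = ∑ aᵢ`... use `N = sup a`
    refine ⟨Finset.univ.sup a, ?_⟩
    rw [Ideal.mem_span_singleton]
    have h1 : ∏ i, z i ^ a i ∣ (∏ i, z i) ^ Finset.univ.sup a := by
      rw [← Finset.prod_pow]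
      exact Finset.prod_dvd_prod_of_dvd _ _ fun i _ =>
        pow_dvd_pow (z i) (Finset.le_sup (Finset.mem_univ i))
    exact hu.mul_left_dvd.mpr h1

end IsRsopPart

/-! ## Divisors of a product of prime elements -/

/-- **A divisor of a product of prime elements is, up to a unit, a subproduct** (in a
cancellative commutative monoid with zero): if `f g = ∏ pᵢ` with all `pᵢ` prime then
`f ~ ∏_{i ∈ s} pᵢ` for some `s`. (Induction: `p₀` divides `f` or `g`; cancel it.) [folklore] -/
theorem exists_associated_prod_of_mul_eq_prod {M : Type*} [CommMonoidWithZero M] [IsCancelMulZero M]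
    {n : ℕ} {p : Fin n → M} (hp : ∀ i, Prime (p i)) {f g : M} (h : f * g = ∏ i, p i) :
    ∃ s : Finset (Fin n), Associated f (∏ i ∈ s, p i) := by
  classical
  induction n generalizing f g with
  | zero =>
    rw [Finset.univ_eq_empty, Finset.prod_empty] at h
    exact ⟨∅, by rw [Finset.prod_empty]; exact associated_one_iff_isUnit.mpr (IsUnit.of_mul_eq_one g h)⟩
  | succ n ih =>
    rw [Fin.prod_univ_succ] at h
    have hp0 : p 0 ∣ f * g := ⟨_, h⟩
    rcases (hp 0).dvd_or_dvd hp0 with ⟨f', rfl⟩ | ⟨g', rfl⟩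
    · -- `p₀ | f`
      have h' : f' * g = ∏ i : Fin n, p i.succ := by
        apply mul_left_cancel₀ (hp 0).ne_zero
        rw [← h, mul_assoc]
      obtain ⟨s, hs⟩ := ih (fun i => hp i.succ) h'
      refine ⟨insert 0 (s.map (Fin.succEmb n)), ?_⟩
      rw [Finset.prod_insert (by simp), Finset.prod_map]
      exact Associated.mul_left (p 0) hs
    · -- `p₀ | g`
      have h' : f * g' = ∏ i : Fin n, p i.succ := by
        apply mul_left_cancel₀ (hp 0).ne_zero
        rw [← h, mul_left_comm]
      obtain ⟨s, hs⟩ := ih (fun i => hp i.succ) h'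
      refine ⟨s.map (Fin.succEmb n), ?_⟩
      rw [Finset.prod_map]
      exact hs

namespace IsRsopPart

variable [IsLocalRing R] {n : ℕ} {z : Fin n → R}

/-- A prime element dividing `∏ zᵢ` is associated to one of the `zᵢ`. [folklore] -/
theorem exists_associated_of_prime_dvd_prod (hz : IsRsopPart z) {p : R} (hp : Prime p)
    (h : p ∣ ∏ i, z i) : ∃ i, Associated p (z i) := by
  haveI := hz.isRegularLocalRing
  haveI := isDomain_of_isRegularLocalRing R
  obtain ⟨i, -, hi⟩ := (hp.dvd_finsetProd_iff _).mp h
  exact ⟨i, hp.irreducible.associated_of_dvd (hz.prime i).irreducible hi⟩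

/-- A divisor of `∏ zᵢ` is associated to a subproduct. [folklore] -/
theorem exists_associated_prod_of_dvd_prod (hz : IsRsopPart z) {f : R} (h : f ∣ ∏ i, z i) :
    ∃ s : Finset (Fin n), Associated f (∏ i ∈ s, z i) := by
  haveI := hz.isRegularLocalRing
  haveI := isDomain_of_isRegularLocalRing R
  obtain ⟨g, hg⟩ := h
  exact exists_associated_prod_of_mul_eq_prod hz.prime hg.symm

/-! ## Intersections with the ideal of a coordinate subspace -/

/-- **`(∏ fⱼ) ∩ (c₁, …, c_m) = (∏ fⱼ) · (c₁, …, c_m)`** when `(f, c)` together are part of one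
regular system of parameters: `∏ fⱼ` is a non-zero-divisor modulo the prime ideal `(c)`, which
contains no `fⱼ`. This is the ideal of `F ∪ C` for a strict normal crossings divisor
`F = V(∏ fⱼ)` and the stratum `C = V(c)` at a point. [folklore] -/
theorem span_prod_inf_span_range {k m : ℕ} {f : Fin k → R} {c : Fin m → R}
    (h : IsRsopPart (Fin.append f c)) :
    Ideal.span {∏ j, f j} ⊓ Ideal.span (Set.range c) =
      Ideal.span {∏ j, f j} * Ideal.span (Set.range c) := by
  refine le_antisymm ?_ Ideal.mul_le_inf
  have hprime := h.append_right.isPrime_span_range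
  -- no `fⱼ` lies in `(c)`
  have hf : ∀ j, f j ∉ Ideal.span (Set.range c) := by
    intro j hj
    have hrange : Set.range c = Fin.append f c '' Set.range (Fin.natAdd k) := by
      ext a
      simp only [Set.mem_range, Set.mem_image, exists_exists_eq_and, Fin.append_right]
    refine h.not_mem_span_image (S := Set.range (Fin.natAdd k)) (i := Fin.castAdd m j) ?_ ?_
    · rintro ⟨i, hi⟩
      have h1 : (Fin.natAdd k i : ℕ) = (Fin.castAdd m j : ℕ) := congrArg Fin.val hi
      rw [Fin.val_natAdd, Fin.val_castAdd] at h1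
      have h2 := j.2
      omega
    · rwa [Fin.append_left, ← hrange]
  have hprod : ∏ j, f j ∉ Ideal.span (Set.range c) := by
    intro hmem
    obtain ⟨j, -, hj⟩ := (Ideal.IsPrime.prod_mem_iff (hp := hprime)).mp hmem
    exact hf j hj
  intro a ha
  obtain ⟨ha1, ha2⟩ := Submodule.mem_inf.mp ha
  obtain ⟨b, hb⟩ := Ideal.mem_span_singleton'.mp ha1
  have hba : (∏ j, f j) * b = a := by rw [← hb, mul_comm]
  have hb' : b ∈ Ideal.span (Set.range c) := by
    refine (hprime.mem_or_mem ?_).resolve_left hprod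
    rw [hba]
    exact ha2
  rw [← hba]
  exact Ideal.mul_mem_mul (Ideal.mem_span_singleton_self _) hb'

end IsRsopPart

end Literature.AlgebraicGeometry.Resolution

end
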